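import Summits.Ventures.LatticeQCDFlow.Scoring.U1TorusTopSusceptibilityContinuumTerms
import Summits.Ventures.LatticeQCDFlow.Scoring.U1TorusTopologicalSusceptibilityBessel
import HarnessLib

/-!
# The continuum limit of the topological susceptibility of 2-d `U(1)` at fixed physical volume

HONEST FRAMING: exact (Metropolis-corrected) sampling algorithms for lattice gauge theory;
figures of merit are autocorrelation/cost numbers at stated couplings and volumes; no
continuum-physics claim.

Venture `LatticeQCDFlow` (cell pub-lqcd), sub-topic `Scoring`; FANOUT row 5 (`s0-sun-a`), GEN-15.
NEW WORK of the cell (placement rule).  With the exact Bessel form of `⟨Q²⟩`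
(`Scoring/U1TorusTopologicalSusceptibilityBessel.lean`) normalised by `Z = 2πI₀` —
`⟨Q²⟩_{(ℤ/L)²,β} = (1/4π²)·Σ_n T_n / Σ_n r_n^{L²}`, `r_n = I_{|n|}(β)/I₀(β)`,
`T_n = V r_n^{V−1}⟨v² cos nv⟩_β − V(V−1) r_n^{V−2}⟨v sin nv⟩_β²`, `V = L²`
(`integral_topCharge_sq_eq_normalised`) — and the termwise limits of
`Scoring/U1TorusTopSusceptibilityContinuumTerms.lean`, dominated convergence (majorant
`K(1 + K n²) e^{c} e^{−c|n|}`, `K = v + 1`) gives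

* **`tendsto_integral_topCharge_sq`** — **THE CONTINUUM LIMIT OF `⟨Q²⟩` AT FIXED PHYSICAL VOLUME**:
  if `β_j → ∞`, `L_j ≥ 2` and `L_j²/β_j → v > 0`, then
  `∫ Q² dμ_{L_j,β_j} → (1/(4π²))·Σ_{n∈ℤ}(v − v²n²) e^{−vn²/2} / Σ_{n∈ℤ} e^{−vn²/2}`
  for theory-2's `topCharge` under `wilsonMeasure u1Rep`.  (By the differentiated Jacobi identity the
  limit equals `Σ_k k² e^{−2π²k²/v}/Σ_k e^{−2π²k²/v}`, the second moment of the discrete Gaussian of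
  `Scoring/U1TorusTopologicalChargeContinuumLimit.lean`; that identification is NOT typed here.  For
  small `v` the limit is `≈ v/(4π²)`, i.e. `⟨Q²⟩ ≈ L²/(4π²β)`, consistent with `β χ_∞(β) → 1/(4π²)`.)

Elementary given the parents; nothing is cited.  No sampler values.
-/

noncomputable section

open Real Filter Topology Set MeasureTheory intervalIntegral
open scoped ENNReal
open Literature.Analysis.FunctionSpaces
open Literature.MathematicalPhysics.QuantumFieldTheory
open Literature.MathematicalPhysics.QuantumLattice (u1Rep)
open Summit.Ventures.LatticeQCDFlow.Theory2.Lattice (topCharge)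

namespace Summit.Ventures.LatticeQCDFlow.Scoring

/-! ### 1. Domination of the normalised terms -/

/-- `Σ_{n∈ℤ} n² e^{−c|n|} < ∞` for `c > 0`. -/
theorem summable_sq_mul_exp_neg_mul_natAbs {c : ℝ} (hc : 0 < c) :
    Summable fun n : ℤ => (n : ℝ) ^ 2 * Real.exp (-(c * (n.natAbs : ℝ))) := by
  have h := Real.summable_pow_mul_exp_neg_nat_mul 2 hc
  refine summable_int_iff_summable_nat_and_neg.2 ⟨?_, ?_⟩
  · refine h.congr fun n => ?_
    simp only [Int.cast_natCast, Int.natAbs_natCast]; ring_nf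
  · refine h.congr fun n => ?_
    simp only [Int.cast_neg, Int.cast_natCast, Int.natAbs_neg, Int.natAbs_natCast]; ring_nf

/-- **The majorant**: eventually in `j`, for all `n`, `|T_n(j)| ≤ (v+1)(1 + (v+1) n²) e^{c} e^{−c|n|}`
with `c = min(v/8, ½)`, when `β_j → ∞`, `V_j/β_j → v > 0`. -/
theorem abs_topSusc_term_le {β : ℕ → ℝ} {V : ℕ → ℕ} {v : ℝ} (hv0 : 0 < v)
    (hβ : Tendsto β atTop atTop) (hv : Tendsto (fun j => (V j : ℝ) / β j) atTop (𝓝 v)) :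
    ∀ᶠ j in atTop, ∀ n : ℤ,
      |(V j : ℝ) * (besselI n.natAbs (β j) / besselI 0 (β j)) ^ (V j - 1) *
          ((∫ x in (-π)..π, x ^ 2 * Real.cos (n * x) * Real.exp (β j * Real.cos x)) /
            (∫ x in (-π)..π, Real.exp (β j * Real.cos x))) -
        (V j : ℝ) * ((V j - 1 : ℕ) : ℝ) * (besselI n.natAbs (β j) / besselI 0 (β j)) ^ (V j - 2) *
          ((∫ x in (-π)..π, x * Real.sin (n * x) * Real.exp (β j * Real.cos x)) /
            (∫ x in (-π)..π, Real.exp (β j * Real.cos x))) ^ 2| ≤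
        (v + 1) * (1 + (v + 1) * (n : ℝ) ^ 2) *
          (Real.exp (min (v / 2 / 4) (1 / 2)) * Real.exp (-(min (v / 2 / 4) (1 / 2) * (n.natAbs : ℝ)))) := by
  set c := min (v / 2 / 4) (1 / 2) with hc
  -- the shifted volume `V − 2` has the same ratio limit
  have hv' : Tendsto (fun j => ((V j - 2 : ℕ) : ℝ) / β j) atTop (𝓝 v) := by
    have h := hv.sub ((tendsto_inv_atTop_zero.comp hβ).const_mul (2 : ℝ))
    rw [mul_zero, sub_zero] at h
    have hV2 : ∀ᶠ j in atTop, 2 ≤ V j :=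
      (eventually_continuumLimit_bounds hv0 hβ hv).mono fun j hj => hj.2.2.2
    refine h.congr' ?_
    filter_upwards [hV2] with j hj
    rw [Nat.cast_sub hj, sub_div]
    simp [div_eq_mul_inv]
  have hm2 : ∀ᶠ j in atTop, (V j : ℝ) * ((∫ x in (-π)..π, x ^ 2 * Real.exp (β j * Real.cos x)) /
      (∫ x in (-π)..π, Real.exp (β j * Real.cos x))) ≤ v + 1 :=
    (tendsto_mul_sqMoment hβ hv).eventually (eventually_le_nhds (by linarith))
  filter_upwards [eventually_continuumLimit_bounds hv0 hβ hv', hm2, hβ.eventually_gt_atTop 0] with j hj hjm hj0 n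
  obtain ⟨-, hlo, -, h2⟩ := hj
  have hI0 : 0 < besselI 0 (β j) := besselI_pos 0 hj0
  have hZ := integral_exp_mul_cos_neg_pi_pi_pos (β j)
  set r := besselI n.natAbs (β j) / besselI 0 (β j) with hr
  set Z := ∫ x in (-π)..π, Real.exp (β j * Real.cos x) with hZd
  set m2 := (∫ x in (-π)..π, x ^ 2 * Real.exp (β j * Real.cos x)) / Z with hm2d
  set mC := (∫ x in (-π)..π, x ^ 2 * Real.cos (n * x) * Real.exp (β j * Real.cos x)) / Z with hmCd
  set mS := (∫ x in (-π)..π, x * Real.sin (n * x) * Real.exp (β j * Real.cos x)) / Z with hmSd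
  have hr0 : 0 ≤ r := div_nonneg (besselI_pos _ hj0).le hI0.le
  have hr1 : r ≤ 1 := (div_le_one hI0).2 (besselI_le_besselI_zero _ _)
  have hV0 : (0 : ℝ) ≤ V j := by positivity
  have hm20 : 0 ≤ m2 := div_nonneg (intervalIntegral.integral_nonneg (by linarith [Real.pi_pos])
    fun x _ => by positivity) hZ.le
  -- `|mC| ≤ m2`, `|mS| ≤ |n| m2`
  have hmC : |mC| ≤ m2 := by
    rw [hmCd, abs_div, abs_of_pos hZ]
    exact div_le_div_of_nonneg_right (abs_integral_sq_cos_le (β j) n) hZ.le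
  have hmS : |mS| ≤ |(n : ℝ)| * m2 := by
    rw [hmSd, abs_div, abs_of_pos hZ, hm2d, ← mul_div_assoc]
    exact div_le_div_of_nonneg_right (abs_integral_id_sin_le (β j) n) hZ.le
  -- `r^{V−1} ≤ r^{V−2} ≤ e^c e^{−c|n|}`
  have hpow2 : r ^ (V j - 2) ≤ Real.exp c * Real.exp (-(c * (n.natAbs : ℝ))) :=
    besselI_ratio_zero_pow_le hj0 (by positivity) hlo h2 n.natAbs
  have hpow1 : r ^ (V j - 1) ≤ r ^ (V j - 2) := pow_le_pow_of_le_one hr0 hr1 (by omega)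
  have hK : (V j : ℝ) * m2 ≤ v + 1 := hjm
  have hV1 : ((V j - 1 : ℕ) : ℝ) ≤ (V j : ℝ) := by exact_mod_cast Nat.sub_le _ _
  have hV10 : (0 : ℝ) ≤ ((V j - 1 : ℕ) : ℝ) := by positivity
  -- first term
  have t1 : |(V j : ℝ) * r ^ (V j - 1) * mC| ≤ (v + 1) * (Real.exp c * Real.exp (-(c * (n.natAbs : ℝ)))) := by
    rw [abs_mul, abs_mul, abs_of_nonneg hV0, abs_of_nonneg (pow_nonneg hr0 _)]
    calc (V j : ℝ) * r ^ (V j - 1) * |mC| ≤ (V j : ℝ) * r ^ (V j - 2) * m2 := by gcongr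
      _ = (V j : ℝ) * m2 * r ^ (V j - 2) := by ring
      _ ≤ (v + 1) * (Real.exp c * Real.exp (-(c * (n.natAbs : ℝ)))) :=
          mul_le_mul hK hpow2 (pow_nonneg hr0 _) (by linarith)
  -- second term
  have t2 : |(V j : ℝ) * ((V j - 1 : ℕ) : ℝ) * r ^ (V j - 2) * mS ^ 2| ≤
      (v + 1) * ((v + 1) * (n : ℝ) ^ 2) * (Real.exp c * Real.exp (-(c * (n.natAbs : ℝ)))) := by
    rw [abs_mul, abs_mul, abs_mul, abs_of_nonneg hV0, abs_of_nonneg hV10, abs_of_nonneg (pow_nonneg hr0 _),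
      abs_of_nonneg (sq_nonneg _)]
    have hVS : (V j : ℝ) * |mS| ≤ |(n : ℝ)| * (v + 1) := by
      calc (V j : ℝ) * |mS| ≤ (V j : ℝ) * (|(n : ℝ)| * m2) := mul_le_mul_of_nonneg_left hmS hV0
        _ = |(n : ℝ)| * ((V j : ℝ) * m2) := by ring
        _ ≤ |(n : ℝ)| * (v + 1) := mul_le_mul_of_nonneg_left hK (abs_nonneg _)
    have hVS' : ((V j - 1 : ℕ) : ℝ) * |mS| ≤ |(n : ℝ)| * (v + 1) :=
      (mul_le_mul_of_nonneg_right hV1 (abs_nonneg _)).trans hVS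
    have hsq : mS ^ 2 = |mS| * |mS| := by rw [abs_mul_abs_self, sq]
    calc (V j : ℝ) * ((V j - 1 : ℕ) : ℝ) * r ^ (V j - 2) * mS ^ 2
        = ((V j : ℝ) * |mS|) * (((V j - 1 : ℕ) : ℝ) * |mS|) * r ^ (V j - 2) := by rw [hsq]; ring
      _ ≤ (|(n : ℝ)| * (v + 1)) * (|(n : ℝ)| * (v + 1)) * (Real.exp c * Real.exp (-(c * (n.natAbs : ℝ)))) := by
          refine mul_le_mul (mul_le_mul hVS hVS' (by positivity) (by positivity)) hpow2 (pow_nonneg hr0 _)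
            (by positivity)
      _ = (v + 1) * ((v + 1) * (n : ℝ) ^ 2) * (Real.exp c * Real.exp (-(c * (n.natAbs : ℝ)))) := by
          rw [show |(n : ℝ)| * (v + 1) * (|(n : ℝ)| * (v + 1)) = (v + 1) * ((v + 1) * (|(n : ℝ)| * |(n : ℝ)|))
            by ring, abs_mul_abs_self]; ring
  calc _ ≤ |(V j : ℝ) * r ^ (V j - 1) * mC| + |(V j : ℝ) * ((V j - 1 : ℕ) : ℝ) * r ^ (V j - 2) * mS ^ 2| :=
        abs_sub _ _
    _ ≤ _ := by nlinarith [t1, t2]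

/-- **Numerator**: `Σ_n T_n(j) → Σ_n (v − v²n²) e^{−vn²/2}` (dominated convergence). -/
theorem tendsto_tsum_topSusc_terms {β : ℕ → ℝ} {V : ℕ → ℕ} {v : ℝ} (hv0 : 0 < v)
    (hβ : Tendsto β atTop atTop) (hv : Tendsto (fun j => (V j : ℝ) / β j) atTop (𝓝 v)) :
    Tendsto (fun j => ∑' n : ℤ,
        ((V j : ℝ) * (besselI n.natAbs (β j) / besselI 0 (β j)) ^ (V j - 1) *
          ((∫ x in (-π)..π, x ^ 2 * Real.cos (n * x) * Real.exp (β j * Real.cos x)) /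
            (∫ x in (-π)..π, Real.exp (β j * Real.cos x))) -
        (V j : ℝ) * ((V j - 1 : ℕ) : ℝ) * (besselI n.natAbs (β j) / besselI 0 (β j)) ^ (V j - 2) *
          ((∫ x in (-π)..π, x * Real.sin (n * x) * Real.exp (β j * Real.cos x)) /
            (∫ x in (-π)..π, Real.exp (β j * Real.cos x))) ^ 2)) atTop
      (𝓝 (∑' n : ℤ, (v - v ^ 2 * (n : ℝ) ^ 2) * Real.exp (-(v * (n : ℝ) ^ 2 / 2)))) := by
  set c := min (v / 2 / 4) (1 / 2) with hc
  have hc0 : 0 < c := lt_min (by positivity) (by norm_num)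
  have hV2 : ∀ᶠ j in atTop, 2 ≤ V j := (eventually_continuumLimit_bounds hv0 hβ hv).mono fun j hj => hj.2.2.2
  refine tendsto_tsum_of_dominated_convergence
    (bound := fun n : ℤ => (v + 1) * (1 + (v + 1) * (n : ℝ) ^ 2) *
      (Real.exp c * Real.exp (-(c * (n.natAbs : ℝ))))) ?_ (fun n => tendsto_topSusc_term hβ hv hV2 n) ?_
  · have h1 := summable_exp_neg_mul_natAbs hc0
    have h2 := summable_sq_mul_exp_neg_mul_natAbs hc0
    have := ((h1.mul_left ((v + 1) * Real.exp c)).add (h2.mul_left ((v + 1) * (v + 1) * Real.exp c)))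
    refine this.congr fun n => ?_
    ring
  · filter_upwards [abs_topSusc_term_le hv0 hβ hv] with j hj n
    rw [Real.norm_eq_abs]
    exact hj n

/-! ### 2. The normalised exact formula and the limit -/

variable {L : ℕ} [NeZero L]

/-- **The exact `⟨Q²⟩` in normalised form**: for `L ≥ 2` and `β > 0`, with `V = L²`,
`∫ Q² dμ = (1/(4π²)) · Σ_n T_n / Σ_n r_n^V`. -/
theorem integral_topCharge_sq_eq_normalised {β : ℝ} (hβ : 0 < β) (hL : 2 ≤ L) :
    ∫ U, (topCharge U) ^ 2 ∂(wilsonMeasure (d := 2) (L := L) u1Rep β) =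
      1 / (4 * π ^ 2) * (∑' n : ℤ,
        (((L ^ 2 : ℕ) : ℝ) * (besselI n.natAbs β / besselI 0 β) ^ (L ^ 2 - 1) *
          ((∫ x in (-π)..π, x ^ 2 * Real.cos (n * x) * Real.exp (β * Real.cos x)) /
            (∫ x in (-π)..π, Real.exp (β * Real.cos x))) -
        ((L ^ 2 : ℕ) : ℝ) * ((L ^ 2 - 1 : ℕ) : ℝ) * (besselI n.natAbs β / besselI 0 β) ^ (L ^ 2 - 2) *
          ((∫ x in (-π)..π, x * Real.sin (n * x) * Real.exp (β * Real.cos x)) /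
            (∫ x in (-π)..π, Real.exp (β * Real.cos x))) ^ 2)) /
      ∑' n : ℤ, (besselI n.natAbs β / besselI 0 β) ^ (L ^ 2) := by
  have hSpos := tsum_besselI_natAbs_pow_sq_pos β hL
  rw [integral_topCharge_sq_eq_besselI β hL]
  have hπ : 0 < π := Real.pi_pos
  have hI0 : 0 < besselI 0 β := besselI_pos 0 hβ
  have hZ := integral_exp_mul_cos_neg_pi_pi_pos β
  have hZeq : (∫ x in (-π)..π, Real.exp (β * Real.cos x)) = 2 * π * besselI 0 β :=
    integral_exp_mul_cos_neg_pi_pi β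
  obtain ⟨m, hm⟩ : ∃ m, L ^ 2 = m + 2 := ⟨L ^ 2 - 2, by have h4 : 4 ≤ L ^ 2 := (by nlinarith); omega⟩
  have hm1 : L ^ 2 - 1 = m + 1 := by omega
  have hm0 : L ^ 2 - 2 = m := by omega
  rw [hm] at hSpos
  rw [hm1, hm0, hm]
  set I0 := besselI 0 β with hI0d
  -- termwise normalisation of the numerator
  have hN : ∀ n : ℤ, 2 * π * besselI n.natAbs β ^ (m + 1) *
        (∫ v in (-π)..π, v ^ 2 * Real.cos (n * v) * Real.exp (β * Real.cos v)) -
      ((m + 1 : ℕ) : ℝ) * besselI n.natAbs β ^ m *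
        (∫ v in (-π)..π, v * Real.sin (n * v) * Real.exp (β * Real.cos v)) ^ 2 =
      I0 ^ (m + 2) * (4 * π ^ 2 / ((m + 2 : ℕ) : ℝ)) *
        ((((m + 2 : ℕ) : ℝ)) * (besselI n.natAbs β / I0) ^ (m + 1) *
          ((∫ x in (-π)..π, x ^ 2 * Real.cos (n * x) * Real.exp (β * Real.cos x)) /
            (∫ x in (-π)..π, Real.exp (β * Real.cos x))) -
        ((m + 2 : ℕ) : ℝ) * ((m + 1 : ℕ) : ℝ) * (besselI n.natAbs β / I0) ^ m *
          ((∫ x in (-π)..π, x * Real.sin (n * x) * Real.exp (β * Real.cos x)) /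
            (∫ x in (-π)..π, Real.exp (β * Real.cos x))) ^ 2) := by
    intro n
    rw [hZeq]
    set C := ∫ x in (-π)..π, x ^ 2 * Real.cos (n * x) * Real.exp (β * Real.cos x) with hC
    set S := ∫ x in (-π)..π, x * Real.sin (n * x) * Real.exp (β * Real.cos x) with hS
    simp only [div_pow]
    have hm2 : ((m + 2 : ℕ) : ℝ) ≠ 0 := by positivity
    field_simp
    ring
  have hD : ∀ n : ℤ, besselI n.natAbs β ^ (m + 2) = I0 ^ (m + 2) * (besselI n.natAbs β / I0) ^ (m + 2) := by
    intro n; rw [div_pow, mul_div_cancel₀ _ (pow_ne_zero _ hI0.ne')]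
  have hNum : (∑' n : ℤ, (2 * π * besselI n.natAbs β ^ (m + 1) *
        (∫ v in (-π)..π, v ^ 2 * Real.cos (n * v) * Real.exp (β * Real.cos v)) -
      ((m + 1 : ℕ) : ℝ) * besselI n.natAbs β ^ m *
        (∫ v in (-π)..π, v * Real.sin (n * v) * Real.exp (β * Real.cos v)) ^ 2)) =
      I0 ^ (m + 2) * (4 * π ^ 2 / ((m + 2 : ℕ) : ℝ)) * ∑' n : ℤ,
        ((((m + 2 : ℕ) : ℝ)) * (besselI n.natAbs β / I0) ^ (m + 1) *
          ((∫ x in (-π)..π, x ^ 2 * Real.cos (n * x) * Real.exp (β * Real.cos x)) /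
            (∫ x in (-π)..π, Real.exp (β * Real.cos x))) -
        ((m + 2 : ℕ) : ℝ) * ((m + 1 : ℕ) : ℝ) * (besselI n.natAbs β / I0) ^ m *
          ((∫ x in (-π)..π, x * Real.sin (n * x) * Real.exp (β * Real.cos x)) /
            (∫ x in (-π)..π, Real.exp (β * Real.cos x))) ^ 2) := by
    rw [← tsum_mul_left]; exact tsum_congr hN
  have hDen : (∑' n : ℤ, besselI n.natAbs β ^ (m + 2)) = I0 ^ (m + 2) * ∑' n : ℤ, (besselI n.natAbs β / I0) ^ (m + 2) := by
    rw [← tsum_mul_left]; exact tsum_congr hD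
  have hSpos' : 0 < ∑' n : ℤ, (besselI n.natAbs β / I0) ^ (m + 2) := by
    rw [hDen] at hSpos
    exact pos_of_mul_pos_right hSpos (pow_nonneg hI0.le _)
  rw [hNum, hDen]
  have hLr : ((L : ℝ)) ^ 2 = ((m + 2 : ℕ) : ℝ) := by exact_mod_cast hm
  rw [hLr]
  have hm2 : ((m + 2 : ℕ) : ℝ) ≠ 0 := by positivity
  have hI0V : I0 ^ (m + 2) ≠ 0 := pow_ne_zero _ hI0.ne'
  have hSne := hSpos'.ne'
  set N := ∑' n : ℤ,
        ((((m + 2 : ℕ) : ℝ)) * (besselI n.natAbs β / I0) ^ (m + 1) *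
          ((∫ x in (-π)..π, x ^ 2 * Real.cos (n * x) * Real.exp (β * Real.cos x)) /
            (∫ x in (-π)..π, Real.exp (β * Real.cos x))) -
        ((m + 2 : ℕ) : ℝ) * ((m + 1 : ℕ) : ℝ) * (besselI n.natAbs β / I0) ^ m *
          ((∫ x in (-π)..π, x * Real.sin (n * x) * Real.exp (β * Real.cos x)) /
            (∫ x in (-π)..π, Real.exp (β * Real.cos x))) ^ 2) with hNd
  set Sr := ∑' n : ℤ, (besselI n.natAbs β / I0) ^ (m + 2) with hSr
  field_simp
  ring

variable {Ls : ℕ → ℕ} [hNZ : ∀ j, NeZero (Ls j)]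

/-- **THE CONTINUUM LIMIT OF THE TOPOLOGICAL SUSCEPTIBILITY AT FIXED PHYSICAL VOLUME.**  If `β_j → ∞`,
`L_j ≥ 2` and `L_j²/β_j → v > 0`, then for theory-2's topological charge of compact `U(1)` on
`(ℤ/L_j)²`:  `∫ Q² dμ_{L_j,β_j} → (1/(4π²))·Σ_{n∈ℤ}(v − v²n²) e^{−vn²/2} / Σ_{n∈ℤ} e^{−vn²/2}`. -/
theorem tendsto_integral_topCharge_sq {β : ℕ → ℝ} {v : ℝ} (hv0 : 0 < v) (hL : ∀ j, 2 ≤ Ls j)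
    (hβ : Tendsto β atTop atTop) (hv : Tendsto (fun j => ((Ls j ^ 2 : ℕ) : ℝ) / β j) atTop (𝓝 v)) :
    Tendsto (fun j => ∫ U, (topCharge U) ^ 2 ∂(wilsonMeasure (d := 2) (L := Ls j) u1Rep (β j))) atTop
      (𝓝 (1 / (4 * π ^ 2) * (∑' n : ℤ, (v - v ^ 2 * (n : ℝ) ^ 2) * Real.exp (-(v * (n : ℝ) ^ 2 / 2))) /
        ∑' n : ℤ, Real.exp (-(v * (n : ℝ) ^ 2 / 2)))) := by
  have hnum := tendsto_tsum_topSusc_terms hv0 hβ hv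
  have hden := tendsto_tsum_besselI_ratio_pow hv0 hβ hv
  have hDpos : 0 < ∑' n : ℤ, Real.exp (-(v * (n : ℝ) ^ 2 / 2)) := by
    have hsum : Summable fun n : ℤ => Real.exp (-(v * (n : ℝ) ^ 2 / 2)) := by
      refine Summable.of_nonneg_of_le (fun n => (Real.exp_pos _).le) (fun n => ?_)
        (summable_exp_neg_mul_natAbs (by positivity : 0 < v / 2))
      refine Real.exp_le_exp.2 ?_
      rw [Nat.cast_natAbs, Int.cast_abs]
      have : |(n : ℝ)| ≤ (n : ℝ) ^ 2 := by
        rw [← sq_abs]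
        rcases eq_or_ne n 0 with rfl | hn
        · simp
        · have h1 : (1 : ℝ) ≤ |(n : ℝ)| := by
            rw [← Int.cast_abs]; exact_mod_cast Int.one_le_abs hn
          nlinarith
      nlinarith
    exact hsum.tsum_pos (fun n => (Real.exp_pos _).le) 0 (Real.exp_pos _)
  have h := (hnum.div hden hDpos.ne').const_mul (1 / (4 * π ^ 2))
  rw [← mul_div_assoc] at h
  refine h.congr' ?_
  filter_upwards [hβ.eventually_gt_atTop 0] with j hj
  simp only [Pi.div_apply]
  rw [integral_topCharge_sq_eq_normalised hj (hL j), mul_div_assoc]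

end Summit.Ventures.LatticeQCDFlow.Scoring
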